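import Mathlib

/-!
# FunctionalMining/NoGo — junction algebra of the sharp class, I: the FREE-JUNCTION LOOP LAW
# (`SIEVELD.md` §3.4b (8f)), staged by the no-go seat (cell `pub-nsfunc`, nogo gen 23)

Search for candidate a priori estimates; no regularity claim. The planner seat cannot file under
`FunctionalMining/`; this file is STAGED for the prove seat (`pub-nsfunc-nogo/NoGo/STAGING.md`,
filing request #4; pen source `SIEVELD.md` v1.9zzf §3.4b (8f) 'junction algebra', nogo g13–g14).
Companion file (request #5): `TiltedJunctionLoopLaw.lean` (common tilt `s`, the explicit 4-valent
free junction, coplanarity criterion); both files are `import Mathlib` only and independent.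

Context (informal, NOT formalised here — the modelling dictionary). In the sharp class of the static
`E2 / L-λ(λ₁)` framework the strain is piecewise constant with values in the wells
`K(n) = λ (I − 3 n⊗n)`, `|n| = 1` (top eigenvalue `λ`, double, eigenplane `n^⊥`). Two wells `K(n)`,
`K(n')` are Hadamard-compatible across a plane wall with normal `N ∥ n − n'` or `N ∥ n + n'` (walls are
free for the heat-flow cost). A JUNCTION LINE `e` with unit tangent `τ` is where `k ≥ 3` walls containing
`τ` meet; all incident directors have a common tilt `|n_c · τ| = s_e`, and the line tension of `e`
vanishes iff `s_e = 0` ((8f)(T1): the directors are coplanar, all in `τ^⊥`). For such a FREE junction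
everything happens in the cross-section plane `τ^⊥ ≅ ℝ²`: a director is an angle `α` (mod `π`), a wall
is a ray from the junction point at angle `ν`, the director is REFLECTED across each wall
(`α ↦ 2ν − α`; write `δ := ν − α`, so the wall at `ν` takes `ν − δ` to `ν + δ`), and the gradient
`∇u = K + W` (`W` skew) jumps across the wall by a rank-one matrix `a ⊗ N(ν)`.

What this file PROVES (finite-dimensional real algebra only; `[ours, elementary]`):

* `wallJump_eq_smul_vecMulVec`, `wallJump_decomp`, `wallJump_add_transpose`, `wallJump_sub_transpose`,
  `trace_wallJump`, `wallJump_mulVec_tangent`, `hadamard_amplitude_unique`: the unique rank-one jump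
  with wall normal `N(ν)` whose symmetric part is the strain jump `K(ν+δ) − K(ν−δ)` is
  `−6λ sin(2δ) · t(ν) ⊗ N(ν)`; its antisymmetric part is `3λ sin(2δ) · J` (`J` the rotation generator);
  it is trace-free and kills the wall tangent; `dir_sub_dir_reflect` / `dir_add_dir_reflect` record the
  two Hadamard families `N ∥ n ∓ n'`.
* `loop_sum` / `loop_law`: around a junction with walls `i < k`, directors `α (i+1) = α i + 2 δ i`, the
  jumps sum to `(K(α k) − K(α 0)) + 3λ (Σ_{i<k} sin(2 δ i)) · J`; hence, once the director closes up
  (`α k = α 0 + m π`; by `well_eq_well_iff` this IS single-valuedness of the strain), single-valuedness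
  of `∇u` around the line is EQUIVALENT to the scalar LOOP LAW `Σ_{i<k} sin(2 δ_i) = 0` (for `λ ≠ 0`)
  — (8f): 'the loop condition is the single scalar law Σ sin 2δ_i = 0 with Σ 2δ_i ≡ 0 (mod π)'.
* `no_threeValent_free_junction` (`'` = matrix form): for `k = 3` the loop law plus director closure
  force `sin(2δ_i) = 0` for some `i` — that wall is not a wall: NO non-degenerate 3-valent free
  junction exists ((8f): 'sin A + sin B ± sin(A+B) factorises'); free junction lines have valence `≥ 4`.

Nothing here is a statement about Navier–Stokes; the wells, walls and junctions are those of the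
cell's static sharp-interface model for the heat-flow coercivity question `L-λ(λ₁)`
(`TopEigHeatCoercivePos`, OPEN). Second implementation of every identity: pure-python numeric check
`pub-nsfunc-nogo/sieveld/junction/check_identities_num.py` (max residual 3.0e-14 over 2·10⁴ samples).
-/

noncomputable section

namespace Summit.NavierStokesRegularity.FunctionalMining.SharpClass.Junction

open Real Matrix Finset

/-! ## 1. Cross-section objects of a free junction (`τ^⊥ ≅ ℝ²`) -/

/-- In-plane director at angle `α`: `n(α) = (cos α, sin α)`. -/
def dir (α : ℝ) : Fin 2 → ℝ := ![cos α, sin α]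

/-- Unit tangent of the wall ray at angle `ν` (in the cross-section plane). -/
def tangent (ν : ℝ) : Fin 2 → ℝ := ![cos ν, sin ν]

/-- Unit normal of the wall ray at angle `ν`. -/
def normal (ν : ℝ) : Fin 2 → ℝ := ![-sin ν, cos ν]

/-- The rotation generator `J` of the cross-section plane (rotation about the junction tangent `τ`). -/
def J : Matrix (Fin 2) (Fin 2) ℝ := !![0, -1; 1, 0]

/-- Cross-section block of the well `K(n) = λ(I − 3 n⊗n)` with in-plane director `n = dir α`, written
in double-angle form (`well_eq_dir` below identifies it with `λ(δ_ij − 3 n_i n_j)`); the junction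
tangent carries the third eigenvalue `λ` and no jump. -/
def well (lam α : ℝ) : Matrix (Fin 2) (Fin 2) ℝ :=
  !![lam / 2 * (-1 - 3 * cos (2 * α)), lam / 2 * (-(3 * sin (2 * α)));
     lam / 2 * (-(3 * sin (2 * α))), lam / 2 * (-1 + 3 * cos (2 * α))]

/-- The gradient jump across the wall ray at angle `ν` with deviation `δ` (incoming director `ν − δ`,
outgoing director `ν + δ`): `−6λ sin(2δ) · t(ν) ⊗ N(ν)`, written out in double-angle form
(`wallJump_eq_smul_vecMulVec`). -/
def wallJump (lam ν δ : ℝ) : Matrix (Fin 2) (Fin 2) ℝ :=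
  !![3 * lam * sin (2 * δ) * sin (2 * ν), -(3 * lam * sin (2 * δ) * (1 + cos (2 * ν)));
     3 * lam * sin (2 * δ) * (1 - cos (2 * ν)), -(3 * lam * sin (2 * δ) * sin (2 * ν))]

/-! ### trigonometric bookkeeping -/

/-- `cos 2(ν+δ)` in double angles. -/
private theorem cos_two_mul_add' (ν δ : ℝ) :
    cos (2 * (ν + δ)) = cos (2 * ν) * cos (2 * δ) - sin (2 * ν) * sin (2 * δ) := by
  rw [mul_add, cos_add]

/-- `cos 2(ν−δ)` in double angles. -/
private theorem cos_two_mul_sub' (ν δ : ℝ) :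
    cos (2 * (ν - δ)) = cos (2 * ν) * cos (2 * δ) + sin (2 * ν) * sin (2 * δ) := by
  rw [mul_sub, cos_sub]

/-- `sin 2(ν+δ)` in double angles. -/
private theorem sin_two_mul_add' (ν δ : ℝ) :
    sin (2 * (ν + δ)) = sin (2 * ν) * cos (2 * δ) + cos (2 * ν) * sin (2 * δ) := by
  rw [mul_add, sin_add]

/-- `sin 2(ν−δ)` in double angles. -/
private theorem sin_two_mul_sub' (ν δ : ℝ) :
    sin (2 * (ν - δ)) = sin (2 * ν) * cos (2 * δ) - cos (2 * ν) * sin (2 * δ) := by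
  rw [mul_sub, sin_sub]

/-- The double-angle form IS the well `λ(δ_ij − 3 n_i n_j)`, `n = dir α`. -/
theorem well_eq_dir (lam α : ℝ) :
    well lam α = !![lam * (1 - 3 * (cos α * cos α)), lam * (-(3 * (cos α * sin α)));
                   lam * (-(3 * (sin α * cos α))), lam * (1 - 3 * (sin α * sin α))] := by
  have hc : cos (2 * α) = 2 * cos α ^ 2 - 1 := cos_two_mul α
  have hs : sin (2 * α) = 2 * sin α * cos α := sin_two_mul α
  have hp : sin α ^ 2 + cos α ^ 2 = 1 := sin_sq_add_cos_sq α
  ext i j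
  fin_cases i <;> fin_cases j <;> simp [well, hc, hs] <;>
    first | (linear_combination (3 * lam) * hp) | ring

/-- `wallJump` is the rank-one matrix `−6λ sin(2δ) · t(ν) ⊗ N(ν)` (Hadamard jump with wall normal
`N(ν)`). -/
theorem wallJump_eq_smul_vecMulVec (lam ν δ : ℝ) :
    wallJump lam ν δ = (-(6 * lam * sin (2 * δ))) • vecMulVec (tangent ν) (normal ν) := by
  have hc : cos (2 * ν) = 2 * cos ν ^ 2 - 1 := cos_two_mul ν
  have hs : sin (2 * ν) = 2 * sin ν * cos ν := sin_two_mul ν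
  have hp : sin ν ^ 2 + cos ν ^ 2 = 1 := sin_sq_add_cos_sq ν
  ext i j
  fin_cases i <;> fin_cases j <;> simp [wallJump, tangent, normal, hc, hs] <;>
    first | (linear_combination (-(6 * lam * sin (2 * δ))) * hp) | ring

/-- The two Hadamard families. Reflecting the director across the wall ray: `n(α) − n(2ν − α)` is
parallel to the wall NORMAL (family `N ∥ n − n'`)… -/
theorem dir_sub_dir_reflect (α ν : ℝ) :
    dir α - dir (2 * ν - α) = (2 * sin (α - ν)) • normal ν := by
  have h1 : α = ν + (α - ν) := by ring
  have h2 : 2 * ν - α = ν - (α - ν) := by ring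
  ext i
  fin_cases i
  · simp [dir, normal]
    rw [h2, cos_sub]; conv_lhs => rw [h1, cos_add]
    ring
  · simp [dir, normal]
    rw [h2, sin_sub]; conv_lhs => rw [h1, sin_add]
    ring

/-- … and `n(α) + n(2ν − α)` is parallel to the wall TANGENT, i.e. normal to the perpendicular ray
`ν + π/2` (family `N ∥ n + n'`; as unoriented directors both walls reflect `α ↦ 2ν − α (mod π)`). -/
theorem dir_add_dir_reflect (α ν : ℝ) :
    dir α + dir (2 * ν - α) = (2 * cos (α - ν)) • tangent ν := by
  have h1 : α = ν + (α - ν) := by ring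
  have h2 : 2 * ν - α = ν - (α - ν) := by ring
  ext i
  fin_cases i
  · simp [dir, tangent]
    rw [h2, cos_sub]; conv_lhs => rw [h1, cos_add]
    ring
  · simp [dir, tangent]
    rw [h2, sin_sub]; conv_lhs => rw [h1, sin_add]
    ring

/-! ## 2. The wall jump: symmetric part = strain jump, antisymmetric part = `3λ sin 2δ · J` -/

/-- **Wall-jump decomposition.** `jump = (K(ν+δ) − K(ν−δ)) + 3λ sin(2δ) · J`: the symmetric part of the
Hadamard jump is the strain jump between the two wells, the antisymmetric part (jump of the local
rotation `W`) is `3λ sin(2δ)` times the rotation generator. [ours, elementary; SIEVELD §3.4b (8f)] -/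
theorem wallJump_decomp (lam ν δ : ℝ) :
    wallJump lam ν δ = (well lam (ν + δ) - well lam (ν - δ)) + (3 * lam * sin (2 * δ)) • J := by
  ext i j
  fin_cases i <;> fin_cases j <;>
    simp [wallJump, well, J, cos_two_mul_add', cos_two_mul_sub', sin_two_mul_add',
      sin_two_mul_sub'] <;> ring

/-- Symmetric part: `jump + jumpᵀ = 2 (K(ν+δ) − K(ν−δ))`. -/
theorem wallJump_add_transpose (lam ν δ : ℝ) :
    wallJump lam ν δ + (wallJump lam ν δ)ᵀ = (2 : ℝ) • (well lam (ν + δ) - well lam (ν - δ)) := by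
  ext i j
  fin_cases i <;> fin_cases j <;>
    simp [wallJump, well, cos_two_mul_add', cos_two_mul_sub', sin_two_mul_add',
      sin_two_mul_sub'] <;> ring

/-- Antisymmetric part: `jump − jumpᵀ = 6λ sin(2δ) · J`, i.e. `W⁺ − W⁻ = 3λ sin(2δ) · J`. -/
theorem wallJump_sub_transpose (lam ν δ : ℝ) :
    wallJump lam ν δ - (wallJump lam ν δ)ᵀ = (6 * lam * sin (2 * δ)) • J := by
  ext i j
  fin_cases i <;> fin_cases j <;> simp [wallJump, J] <;> ring

/-- The jump is trace-free (compatible with `div u = 0` on both sides). -/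
theorem trace_wallJump (lam ν δ : ℝ) : trace (wallJump lam ν δ) = 0 := by
  simp [wallJump, trace_fin_two_of]

/-- The jump kills the wall tangent: `∇u⁺ t = ∇u⁻ t` (continuity of `u` along the wall). -/
theorem wallJump_mulVec_tangent (lam ν δ : ℝ) : wallJump lam ν δ *ᵥ tangent ν = 0 := by
  have hc : cos (2 * ν) = 2 * cos ν ^ 2 - 1 := cos_two_mul ν
  have hs : sin (2 * ν) = 2 * sin ν * cos ν := sin_two_mul ν
  have hp : sin ν ^ 2 + cos ν ^ 2 = 1 := sin_sq_add_cos_sq ν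
  ext i
  fin_cases i <;> simp [wallJump, tangent, mulVec, dotProduct, Fin.sum_univ_two, hc, hs] <;>
    first | (linear_combination (-(6 * lam * sin (2 * δ) * cos ν)) * hp) | ring

/-- Uniqueness of the Hadamard amplitude: if a rank-one matrix `a ⊗ N(ν)` has the strain jump as its
symmetric part, then `a = −6λ sin(2δ) t(ν)`, i.e. `a ⊗ N(ν)` IS `wallJump` (no freedom is left in the
skew part once the wall normal is fixed). -/
theorem hadamard_amplitude_unique (lam ν δ : ℝ) (a : Fin 2 → ℝ)
    (h : vecMulVec a (normal ν) + (vecMulVec a (normal ν))ᵀ =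
      (2 : ℝ) • (well lam (ν + δ) - well lam (ν - δ))) :
    vecMulVec a (normal ν) = wallJump lam ν δ := by
  -- compare with the known solution: the difference `b ⊗ N`, `b = a + 6λ sin(2δ) t`, has zero
  -- symmetric part; contracting with `(N, N)` and `(t, N)` gives `b·N = 0 = b·t`, so `b = 0`.
  have hw := wallJump_add_transpose lam ν δ
  rw [wallJump_eq_smul_vecMulVec] at hw ⊢
  have hp : sin ν ^ 2 + cos ν ^ 2 = 1 := sin_sq_add_cos_sq ν
  -- entrywise consequences of `h` and `hw`
  have e00 := congr_fun (congr_fun h 0) 0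
  have e01 := congr_fun (congr_fun h 0) 1
  have e11 := congr_fun (congr_fun h 1) 1
  have f00 := congr_fun (congr_fun hw 0) 0
  have f01 := congr_fun (congr_fun hw 0) 1
  have f11 := congr_fun (congr_fun hw 1) 1
  simp [tangent, normal, Matrix.add_apply, Matrix.transpose_apply,
    Matrix.smul_apply] at e00 e01 e11 f00 f01 f11
  -- set `c := −6λ sin 2δ`; unknowns `a 0, a 1`; the linear system has the unique solution `c • t`
  set c : ℝ := -(6 * lam * sin (2 * δ)) with hc
  have hb0 : (a 0 - c * cos ν) * sin ν = 0 := by nlinarith [e00, f00]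
  have hb1 : (a 1 - c * sin ν) * cos ν = 0 := by nlinarith [e11, f11]
  have hb2 : (a 0 - c * cos ν) * cos ν - (a 1 - c * sin ν) * sin ν = 0 := by
    nlinarith [e01, f01, e00, f00, e11, f11]
  -- from hb0, hb1, hb2 and sin² + cos² = 1: both components of `b` vanish
  have hB0 : a 0 - c * cos ν = 0 := by
    have h1 : (a 0 - c * cos ν) * (sin ν ^ 2 + cos ν ^ 2) =
        (a 0 - c * cos ν) * sin ν * sin ν + ((a 1 - c * sin ν) * sin ν) * cos ν +
          ((a 0 - c * cos ν) * cos ν - (a 1 - c * sin ν) * sin ν) * cos ν := by ring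
    rw [hp, mul_one, hb0, hb2] at h1
    have h2 : (a 1 - c * sin ν) * sin ν * cos ν = ((a 1 - c * sin ν) * cos ν) * sin ν := by ring
    rw [h1, h2, hb1]; ring
  have hB1 : a 1 - c * sin ν = 0 := by
    have h1 : (a 1 - c * sin ν) * (sin ν ^ 2 + cos ν ^ 2) =
        (a 1 - c * sin ν) * cos ν * cos ν + (a 1 - c * sin ν) * sin ν * sin ν := by ring
    rw [hp, mul_one, hb1] at h1
    have h3 : (a 1 - c * sin ν) * sin ν = (a 0 - c * cos ν) * cos ν -
        ((a 0 - c * cos ν) * cos ν - (a 1 - c * sin ν) * sin ν) := by ring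
    rw [h1, h3, hb2, hB0]; ring
  have ha0 : a 0 = c * cos ν := by linarith
  have ha1 : a 1 = c * sin ν := by linarith
  ext i j
  fin_cases i <;> fin_cases j <;> simp [vecMulVec_apply, tangent, normal, ha0, ha1] <;> ring

/-! ## 3. The loop law around a free junction line -/

/-- Director closure: the well only sees the director mod `π`. -/
theorem well_add_int_mul_pi (lam α : ℝ) (m : ℤ) : well lam (α + m * π) = well lam α := by
  have h : 2 * (α + m * π) = 2 * α + m * (2 * π) := by ring
  simp only [well, h, cos_add_int_mul_two_pi, sin_add_int_mul_two_pi]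

/-- Conversely the cross-section strain determines the director mod `π`: for `λ ≠ 0`,
`K(α) = K(β) ↔ 2α ≡ 2β (mod 2π)` (stated through `cos, sin` of the double angle). So 'the strain is
single-valued around the line' is exactly director closure mod `π`, the hypothesis of `loop_law`. -/
theorem well_eq_well_iff (lam α β : ℝ) (hlam : lam ≠ 0) :
    well lam α = well lam β ↔ (cos (2 * α) = cos (2 * β) ∧ sin (2 * α) = sin (2 * β)) := by
  constructor
  · intro h
    have h00 := congr_fun (congr_fun h 0) 0
    have h01 := congr_fun (congr_fun h 0) 1
    simp [well, hlam] at h00 h01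
    exact ⟨h00, h01⟩
  · rintro ⟨hc, hs⟩
    simp only [well, hc, hs]

/-- **Loop sum.** Walls `i < k` around the junction, wall `i` at angle `α i + δ i` taking the director
`α i` to `α (i+1) = α i + 2 δ i`: the jumps telescope in their symmetric parts and add up in their
antisymmetric parts. -/
theorem loop_sum (lam : ℝ) (α δ : ℕ → ℝ) (k : ℕ)
    (hrefl : ∀ i, i < k → α (i + 1) = α i + 2 * δ i) :
    ∑ i ∈ range k, wallJump lam (α i + δ i) (δ i) =
      (well lam (α k) - well lam (α 0)) + (3 * lam * ∑ i ∈ range k, sin (2 * δ i)) • J := by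
  induction k with
  | zero => simp
  | succ k ih =>
    have ih' := ih (fun i hi => hrefl i (Nat.lt_succ_of_lt hi))
    have hk : α (k + 1) = α k + 2 * δ k := hrefl k (Nat.lt_succ_self k)
    rw [sum_range_succ, sum_range_succ, ih', wallJump_decomp]
    have e1 : α k + δ k + δ k = α (k + 1) := by rw [hk]; ring
    have e2 : α k + δ k - δ k = α k := by ring
    rw [e1, e2, mul_add, add_smul]
    abel

/-- **The free-junction loop law (SIEVELD §3.4b (8f)).** If the director closes up around the line
(`α k = α 0 + m π`), the total jump of `∇u` around the junction is `3λ (Σ_{i<k} sin 2δ_i) · J`; so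
`∇u` is single-valued around the line iff `λ = 0` or `Σ_{i<k} sin(2 δ_i) = 0`. -/
theorem loop_law (lam : ℝ) (α δ : ℕ → ℝ) (k : ℕ) (m : ℤ)
    (hrefl : ∀ i, i < k → α (i + 1) = α i + 2 * δ i) (hclos : α k = α 0 + m * π) :
    ∑ i ∈ range k, wallJump lam (α i + δ i) (δ i) = 0 ↔
      lam = 0 ∨ ∑ i ∈ range k, sin (2 * δ i) = 0 := by
  rw [loop_sum lam α δ k hrefl, hclos, well_add_int_mul_pi, sub_self, zero_add]
  constructor
  · intro h
    have h10 := congr_fun (congr_fun h 1) 0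
    simp [J, Matrix.smul_apply] at h10
    rcases h10 with h | h
    · exact Or.inl h
    · exact Or.inr h
  · rintro (h | h) <;> simp [h]

/-! ## 4. No non-degenerate 3-valent free junction

The two factorisations below are the trigonometric core; the first is literally
`E2.TheoremSCore.sin_two_mul_add_sin_two_mul_sub` of the tree (census-1 g22 / prove g9, eikonal form,
with `E2.TheoremSCore.no_three_valent_vertex` = no 3-valent vertex for jumps summing to `0`), restated
here only to keep this file `import Mathlib`-only. New in this file is the matrix side: closure mod `π`
with the parity split (`m` even / odd) and the matrix form `no_threeValent_free_junction'`. -/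

/-- `sin 2a + sin 2b − sin(2a + 2b) = 4 sin a · sin b · sin(a + b)`
(= `E2.TheoremSCore.sin_two_mul_add_sin_two_mul_sub`). -/
theorem sin_add_sin_sub_sin_add (a b : ℝ) :
    sin (2 * a) + sin (2 * b) - sin (2 * a + 2 * b) = 4 * sin a * sin b * sin (a + b) := by
  have e : 2 * a + 2 * b = 2 * (a + b) := by ring
  rw [e, sin_two_mul, sin_two_mul, sin_two_mul, sin_add, cos_add]
  have ha := sin_sq_add_cos_sq a
  have hb := sin_sq_add_cos_sq b
  linear_combination (-(2 * sin a * cos a)) * hb + (-(2 * sin b * cos b)) * ha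

/-- `sin 2a + sin 2b + sin(2a + 2b) = 4 cos a · cos b · sin(a + b)`. -/
theorem sin_add_sin_add_sin_add (a b : ℝ) :
    sin (2 * a) + sin (2 * b) + sin (2 * a + 2 * b) = 4 * cos a * cos b * sin (a + b) := by
  have e : 2 * a + 2 * b = 2 * (a + b) := by ring
  rw [e, sin_two_mul, sin_two_mul, sin_two_mul, sin_add, cos_add]
  have ha := sin_sq_add_cos_sq a
  have hb := sin_sq_add_cos_sq b
  linear_combination (-(2 * sin a * cos a)) * hb + (-(2 * sin b * cos b)) * ha

/-- **No non-degenerate 3-valent free junction (SIEVELD §3.4b (8f)).** Three walls with deviations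
`δ₀, δ₁, δ₂`, director closure `2δ₀ + 2δ₁ + 2δ₂ = m π` and the loop law force `sin(2δ_i) = 0` for some
`i` — across that wall the director does not change (mod `π`), so it is not a wall: a free junction
line has valence `≥ 4`. [ours, elementary] -/
theorem no_threeValent_free_junction (δ₀ δ₁ δ₂ : ℝ) (m : ℤ)
    (hclos : 2 * δ₀ + 2 * δ₁ + 2 * δ₂ = m * π)
    (hloop : sin (2 * δ₀) + sin (2 * δ₁) + sin (2 * δ₂) = 0) :
    sin (2 * δ₀) = 0 ∨ sin (2 * δ₁) = 0 ∨ sin (2 * δ₂) = 0 := by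
  have h2 : 2 * δ₂ = -(2 * δ₀ + 2 * δ₁) + m * π := by linarith
  have hs2 : sin (2 * δ₂) = -((-1 : ℝ) ^ m * sin (2 * δ₀ + 2 * δ₁)) := by
    rw [h2, sin_add_int_mul_pi, sin_neg]; ring
  -- `sin(2δ₀ + 2δ₁) = 0` already gives `sin 2δ₂ = 0`
  have key : sin (2 * δ₀ + 2 * δ₁) = 0 → sin (2 * δ₂) = 0 := by
    intro h; rw [hs2, h]; ring
  have hsum : sin (2 * (δ₀ + δ₁)) = 2 * sin (δ₀ + δ₁) * cos (δ₀ + δ₁) := sin_two_mul _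
  have e2 : 2 * (δ₀ + δ₁) = 2 * δ₀ + 2 * δ₁ := by ring
  rw [e2] at hsum
  rcases Int.even_or_odd m with hm | hm
  · -- `m` even: `sin 2δ₀ + sin 2δ₁ − sin(2δ₀+2δ₁) = 0 = 4 sin δ₀ sin δ₁ sin(δ₀+δ₁)`
    rw [hs2, hm.neg_one_zpow, one_mul, ← sub_eq_add_neg, sin_add_sin_sub_sin_add] at hloop
    rcases mul_eq_zero.mp hloop with h | h
    · rcases mul_eq_zero.mp h with h | h
      · rcases mul_eq_zero.mp h with h | h
        · norm_num at h
        · left; rw [sin_two_mul, h]; ring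
      · right; left; rw [sin_two_mul, h]; ring
    · right; right; apply key; rw [hsum, h]; ring
  · -- `m` odd: `sin 2δ₀ + sin 2δ₁ + sin(2δ₀+2δ₁) = 0 = 4 cos δ₀ cos δ₁ sin(δ₀+δ₁)`
    rw [hs2, hm.neg_one_zpow, neg_mul, one_mul, neg_neg, sin_add_sin_add_sin_add] at hloop
    rcases mul_eq_zero.mp hloop with h | h
    · rcases mul_eq_zero.mp h with h | h
      · rcases mul_eq_zero.mp h with h | h
        · norm_num at h
        · left; rw [sin_two_mul, h]; ring
      · right; left; rw [sin_two_mul, h]; ring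
    · right; right; apply key; rw [hsum, h]; ring

/-- Matrix form: three walls around a free junction with single-valued `∇u` (`λ ≠ 0`) have a degenerate
wall. -/
theorem no_threeValent_free_junction' (lam : ℝ) (hlam : lam ≠ 0) (α δ : ℕ → ℝ) (m : ℤ)
    (hrefl : ∀ i, i < 3 → α (i + 1) = α i + 2 * δ i) (hclos : α 3 = α 0 + m * π)
    (hsingle : ∑ i ∈ range 3, wallJump lam (α i + δ i) (δ i) = 0) :
    ∃ i, i < 3 ∧ sin (2 * δ i) = 0 := by
  have hl := (loop_law lam α δ 3 m hrefl hclos).mp hsingle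
  rcases hl with h | h
  · exact absurd h hlam
  · have h3 : ∑ i ∈ range 3, sin (2 * δ i) = sin (2 * δ 0) + sin (2 * δ 1) + sin (2 * δ 2) := by
      simp [sum_range_succ]
    have hc : 2 * δ 0 + 2 * δ 1 + 2 * δ 2 = m * π := by
      have h0 := hrefl 0 (by norm_num); have h1 := hrefl 1 (by norm_num)
      have h2 := hrefl 2 (by norm_num)
      simp only [zero_add] at h0
      norm_num at h1 h2
      linarith
    rw [h3] at h
    rcases no_threeValent_free_junction (δ 0) (δ 1) (δ 2) m hc h with h' | h' | h'
    · exact ⟨0, by norm_num, h'⟩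
    · exact ⟨1, by norm_num, h'⟩
    · exact ⟨2, by norm_num, h'⟩


end Summit.NavierStokesRegularity.FunctionalMining.SharpClass.Junction
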